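import Summits.BirchSwinnertonDyer.BirchSwinnertonDyer.Theorems.EisensteinDepletionAtTwoStarEisEightSmoothing
import HarnessLib

/-!
# Route `EisensteinDepletionAtTwo`, crux E1M `DepletedLambdaLawAtTwoMod` (item stmt-BirchSwinnertonDyer-20341),
# line `star`, skeleton v3 — **(★-EisEight) in the `2`-adic form: `‖v(m,a)‖₂ ≤ 8⁻¹` on `C`** (`8 ∣ v` up to the odd
# denominators of the stabilisation coefficients), `v = stabEisCuspDiff N β`, odd `N`, admissible `β`

Cell `bsd-rank2`, seat `bsd-rank2-eng-2` GEN 8. THEOREMS ONLY — no definition, no named fact, no `sorry`. HONEST FRAMING: pure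
`2`-adic arithmetic of Dedekind–Rademacher sums (no elliptic curve); closes the registered stub `stub_starEisEight` of
`Cruxes/…/Lines/star.lean` v3 once RETYPED to lit GEN 21's corrected form (19:30Z: the `ℤ`-form `v = 8n` is false since
`v ∈ ℤ[1/rad N]`, e.g. `v(3,5) = 48/7` at `N = 21`; the `2`-adic form below is what the glue consumes). Nothing here reads an
analytic rank; (★-SymbC)/(★)/E1M are NOT proved; BSD is not proved by any of this (PARTITION D-0054: none — r_an ≥ 2 axis S0,
door T-r3₂). ROAD (lit GEN 21 18:58Z/19:30Z): apply the mod-`8` rigidity theorem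
`Literature.NumberTheory.EllipticCurves.norm_le_eighth_of_stevensSmoothing` (p558349) to the `α = 1` cusp-difference function
`f(a + 2^Lℤ₂) = v(L, A) − v(L−1, A mod 2^{L−1})` on the `η = +1` classes of the levels `L ≥ 3`: (i) `‖f‖ ≤ 1`
(`norm_stabEisCuspDiff_le_one`); (ii) `‖Sm_5^5 f‖ ≤ 8⁻¹` — `Sm f = −12·Sm E + c_β·(integer) − 16·(2-adic integer)` pointwise
(`…StarSmoothedMeasure` §D at scale `1`, levels `≥ 3`) and `‖Sm E‖ ≤ ½` (lit `norm_smoothedEisensteinDedekindTwo_le_half`);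
(iii) the tower relation holds `mod 8` up to a level constant: the Dedekind part `E` is an exact distribution
(`eisensteinDedekindTwo_distribution`), and the Bézout boundary part has tower defect `c_β·(½ + ℤ) ⊂ 8ℤ₂`
(`N·y_{X,k} ≡ X⁻¹ (mod 2^k)` only; `‖c_β‖₂ ≤ 2⁻⁴`); (iv) `f(1) = 0`. Then `‖f‖ ≤ 8⁻¹` from level `3` on, and
`v(L, a) = f + v(L−1, ā)` telescopes down to `v(2, 1) = 0`.

* `two_pow_dvd_bezout`, `two_pow_dvd_sub_of_inverses` (Bézout inverses agree), `norm_tower_cuspDiff_le_eighth` ((iii)),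
  `norm_cuspDiff_le_eighth` (rigidity applied: the `α = 1` differences are `≡ 0 mod 8`), **`starEisEight₂`**:
  `∀ N odd, β admissible, ∀ (m,a) ∈ C, ‖stabEisCuspDiff N β m a‖₂ ≤ 8⁻¹` ((ii) is the prequel file `…StarEisEightSmoothing.lean`).

References: G. Stevens, *Arithmetic on Modular Curves* (1982), §5.2, §5.4 [Stevens1982]; B. Mazur, J. Tate, J. Teitelbaum,
Invent. Math. 84 (1986), §I.10–I.11 [MazurTateTeitelbaum1986Invent]; H. Rademacher, E. Grosswald, *Dedekind Sums* (1972), Ch. 4 A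
[RademacherGrosswald1972].
-/

set_option linter.dupNamespace false
set_option autoImplicit false

noncomputable section

open scoped Classical

open Filter Topology Literature.NumberTheory.EllipticCurves Literature.NumberTheory.ModularForms
  Summit.BirchSwinnertonDyer.Rank1Residual.X1.MuLambda

namespace Summit.BirchSwinnertonDyer.BirchSwinnertonDyer.Theorems.DepletionAtTwo

section EisEight

variable {N : ℕ} {β : ℕ → ℕ}

/-- Euclid at a power of `2`: `2^k ∣ A·Z` with `A` odd forces `2^k ∣ Z`. [folklore] -/
theorem two_pow_dvd_of_dvd_odd_mul {k : ℕ} {A Z : ℤ} (hA : Odd A) (h : ((2 ^ k : ℕ) : ℤ) ∣ A * Z) :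
    ((2 ^ k : ℕ) : ℤ) ∣ Z := by
  refine Int.dvd_of_dvd_mul_right_of_gcd_one h ?_
  have := int_gcd_two_pow_eq_one odd_one hA k
  rwa [Nat.cast_one, mul_one] at this

/-- The Bézout congruence at level `k`: `2^k ∣ X·(N·y_{X,k}) − 1` for odd `X`, odd `N`. [folklore] -/
theorem two_pow_dvd_bezout (hodd : Odd N) (k : ℕ) {X : ℤ} (hX : Odd X) :
    ((2 ^ k : ℕ) : ℤ) ∣ X * ((N : ℤ) * Int.gcdB ((2 ^ k : ℕ) : ℤ) (X * N)) - 1 := by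
  have e := Int.gcd_eq_gcd_ab ((2 ^ k : ℕ) : ℤ) (X * N)
  rw [int_gcd_two_pow_eq_one hodd hX k, Nat.cast_one] at e
  exact ⟨-Int.gcdA ((2 ^ k : ℕ) : ℤ) (X * N), by linear_combination -e⟩

/-- Two Bézout-type inverses agree: `2^j ∣ A Y₁ − 1`, `2^j ∣ A' Y₂ − 1`, `2^j ∣ A − A'`, `A` odd ⇒ `2^j ∣ Y₁ − Y₂`. [folklore] -/
theorem two_pow_dvd_sub_of_inverses {j : ℕ} {A A' Y₁ Y₂ : ℤ} (hA : Odd A) (h1 : ((2 ^ j : ℕ) : ℤ) ∣ A * Y₁ - 1)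
    (h2 : ((2 ^ j : ℕ) : ℤ) ∣ A' * Y₂ - 1) (h3 : ((2 ^ j : ℕ) : ℤ) ∣ A - A') :
    ((2 ^ j : ℕ) : ℤ) ∣ Y₁ - Y₂ := by
  refine two_pow_dvd_of_dvd_odd_mul hA ?_
  have e : A * (Y₁ - Y₂) = (A * Y₁ - 1) - (A' * Y₂ - 1) - (A - A') * Y₂ := by ring
  rw [e]
  exact dvd_sub (dvd_sub h1 h2) (dvd_mul_of_dvd_left h3 _)

/-- **(iii): the tower relation `mod 8` up to a level constant** for the `α = 1` cusp-difference function `f` on the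
`η = +1` classes (levels `m + 2`, `m ≥ 1`): `‖∑_{b ↦ a} f(b) − f(a) − κ_m‖₂ ≤ 8⁻¹`. The Dedekind part is an exact distribution
(`eisensteinDedekindTwo_distribution`); the Bézout boundary part has tower defect `c_β·(½ + ℤ)` because
`N y_{A,L+1} + N y_{A+2^L,L+1} − 6 N y_{A,L} + 4 N y_{Ā,L−1} ≡ 2^L (mod 2^{L+1})` (from `N·y_{X,k} ≡ X⁻¹ (mod 2^k)` only),
and `‖c_β‖₂ ≤ 2⁻⁴`; the `a = 1` normalisation contributes the constant. [cite: MazurTateTeitelbaum1986Invent, §I.10–I.11]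
[cite: Stevens1982, §2.5 (PDF p. 38)] -/
theorem norm_tower_cuspDiff_le_eighth (hodd : Odd N) (hadm : IsAdmissibleStabData N β) {m : ℕ} (hm : 1 ≤ m) :
    ∃ κ : ℚ_[2], ∀ a : ZMod (2 ^ (m + 2)), a.val % 4 = 1 →
      ‖(∑ b ∈ Finset.univ.filter (fun b : ZMod (2 ^ (m + 2 + 1)) ↦
          ZMod.castHom (pow_dvd_pow 2 (m + 2).le_succ) (ZMod (2 ^ (m + 2))) b = a),
          (fun (n : ℕ) (b : ZMod (2 ^ n)) ↦ if 3 ≤ n ∧ b.val % 4 = 1 then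
            (((stabEisCuspDiff N β n (b.val : ℤ) - stabEisCuspDiff N β (n - 1) ((b.val % 2 ^ (n - 1) : ℕ) : ℤ) : ℚ)) : ℚ_[2])
            else 0) (m + 2 + 1) b) -
        (fun (n : ℕ) (b : ZMod (2 ^ n)) ↦ if 3 ≤ n ∧ b.val % 4 = 1 then
            (((stabEisCuspDiff N β n (b.val : ℤ) - stabEisCuspDiff N β (n - 1) ((b.val % 2 ^ (n - 1) : ℕ) : ℤ) : ℚ)) : ℚ_[2])
            else 0) (m + 2) a - κ‖ ≤ 8⁻¹ := by
  have hN : N ≠ 0 := fun h ↦ by simp [h] at hodd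
  have hT : ∀ t ∈ N.divisors, Odd t := fun t ht ↦ hodd.of_dvd_nat (Nat.dvd_of_mem_divisors ht)
  -- the level data
  set P : ℕ → ℕ → ℚ := fun k X ↦
    stabEisensteinPeriod N β (gammaEntries N X ((2 ^ k : ℕ) : ℤ)).1 (gammaEntries N X ((2 ^ k : ℕ) : ℤ)).2.1
      (gammaEntries N X ((2 ^ k : ℕ) : ℤ)).2.2.1 (gammaEntries N X ((2 ^ k : ℕ) : ℤ)).2.2.2 with hP
  set E : ℕ → ℕ → ℚ := fun k X ↦ ∑ t ∈ N.divisors, stabCoeff N β t *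
    (dedekindSum (t * X : ℤ) (2 ^ k) - dedekindSum (t * X : ℤ) (2 ^ (k - 1))) with hE
  set cβ : ℚ := ∑ t ∈ N.divisors, stabCoeff N β t / t with hcβ
  set Y : ℕ → ℕ → ℤ := fun k X ↦ (N : ℤ) * Int.gcdB ((2 ^ k : ℕ) : ℤ) (X * N) with hY
  refine ⟨-((((2 : ℚ) * (P (m + 3) 1 - P (m + 2) 1) - (P (m + 2) 1 - P (m + 1) 1) : ℚ) : ℚ_[2])), fun a ha ↦ ?_⟩
  set A := a.val with hA
  have hAlt : A < 2 ^ (m + 2) := ZMod.val_lt a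
  have hAodd : Odd A := odd_val_of_mod_four a ha
  have h2L : 2 ^ (m + 2 + 1) = 2 ^ (m + 2) + 2 ^ (m + 2) := by ring
  have hAodd2 : Odd (A + 2 ^ (m + 2)) := hAodd.add_even (Nat.even_pow.mpr ⟨even_two, by omega⟩)
  have h4 : 4 ∣ 2 ^ (m + 2) := ⟨2 ^ m, by ring⟩
  -- the two lifts
  set b₁ : ZMod (2 ^ (m + 2 + 1)) := ((A : ℕ) : ZMod (2 ^ (m + 2 + 1))) with hb₁
  set b₂ : ZMod (2 ^ (m + 2 + 1)) := ((A + 2 ^ (m + 2) : ℕ) : ZMod (2 ^ (m + 2 + 1))) with hb₂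
  have hb₁v : b₁.val = A := by rw [hb₁, ZMod.val_natCast, Nat.mod_eq_of_lt (by omega)]
  have hb₂v : b₂.val = A + 2 ^ (m + 2) := by rw [hb₂, ZMod.val_natCast, Nat.mod_eq_of_lt (by omega)]
  have hb₁4 : b₁.val % 4 = 1 := by rw [hb₁v]; exact ha
  have hb₂4 : b₂.val % 4 = 1 := by rw [hb₂v]; omega
  rw [sum_filter_castHom_eq_add (m + 2) _ a]
  simp only []
  rw [if_pos ⟨by omega, hb₁4⟩, if_pos ⟨by omega, hb₂4⟩, if_pos ⟨by omega, ha⟩, hb₁v, hb₂v,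
    show m + 2 + 1 - 1 = m + 2 by omega, show m + 2 - 1 = m + 1 by omega, Nat.mod_eq_of_lt hAlt,
    show (A + 2 ^ (m + 2)) % 2 ^ (m + 2) = A by rw [Nat.add_mod_right, Nat.mod_eq_of_lt hAlt]]
  -- unfold `v = P − P(1)` and cancel the constants
  have hv : ∀ (k : ℕ) (X : ℕ), stabEisCuspDiff N β k (X : ℤ) = P k X - P k 1 := fun k X ↦ by
    simp only [hP]; unfold stabEisCuspDiff; push_cast; rfl
  have hv1 : ∀ (k : ℕ), stabEisCuspDiff N β k ((1 : ℕ) : ℤ) = 0 := fun k ↦ by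
    rw [Nat.cast_one]; exact stabEisCuspDiff_one N β k
  set Abar := A % 2 ^ (m + 1) with hAbar
  have hcast : ((stabEisCuspDiff N β (m + 2 + 1) (A : ℤ) - stabEisCuspDiff N β (m + 2) (A : ℤ) : ℚ) : ℚ_[2]) +
        ((stabEisCuspDiff N β (m + 2 + 1) ((A + 2 ^ (m + 2) : ℕ) : ℤ) - stabEisCuspDiff N β (m + 2) (A : ℤ) : ℚ) : ℚ_[2]) -
        ((stabEisCuspDiff N β (m + 2) (A : ℤ) - stabEisCuspDiff N β (m + 1) (Abar : ℤ) : ℚ) : ℚ_[2]) -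
        -((((2 : ℚ) * (P (m + 3) 1 - P (m + 2) 1) - (P (m + 2) 1 - P (m + 1) 1) : ℚ) : ℚ_[2])) =
      (((P (m + 3) A - P (m + 2) A) + (P (m + 3) (A + 2 ^ (m + 2)) - P (m + 2) A) -
        (P (m + 2) A - P (m + 1) Abar) : ℚ) : ℚ_[2]) := by
    simp only [hv, show m + 2 + 1 = m + 3 from rfl]
    push_cast; ring
  rw [hcast]
  -- the three `α = 1` combinations in closed form
  have hS1 := stabEisensteinPeriod_sub_level hodd hadm (show 2 ≤ m + 3 by omega) hAodd
  have hS2 := stabEisensteinPeriod_sub_level hodd hadm (show 2 ≤ m + 3 by omega) hAodd2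
  have hS3 := stabEisensteinPeriod_sub_level hodd hadm (show 2 ≤ m + 2 by omega) hAodd
  rw [show m + 3 - 1 = m + 2 by omega, Nat.mod_eq_of_lt hAlt] at hS1
  rw [show m + 3 - 1 = m + 2 by omega, show (A + 2 ^ (m + 2)) % 2 ^ (m + 2) = A by
    rw [Nat.add_mod_right, Nat.mod_eq_of_lt hAlt]] at hS2
  rw [show m + 2 - 1 = m + 1 by omega] at hS3
  have hP1 : P (m + 3) A - P (m + 2) A = -12 * E (m + 3) A + cβ * ((N : ℚ) *
      ((Int.gcdB ((2 ^ (m + 3) : ℕ) : ℤ) (A * N) : ℚ) / (2 ^ (m + 3) : ℕ) -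
        (Int.gcdB ((2 ^ (m + 2) : ℕ) : ℤ) ((A : ℤ) * N) : ℚ) / (2 ^ (m + 2) : ℕ))) := by
    simp only [hP, hE, hcβ]; exact_mod_cast hS1
  have hP2 : P (m + 3) (A + 2 ^ (m + 2)) - P (m + 2) A = -12 * E (m + 3) (A + 2 ^ (m + 2)) + cβ * ((N : ℚ) *
      ((Int.gcdB ((2 ^ (m + 3) : ℕ) : ℤ) (((A + 2 ^ (m + 2) : ℕ) : ℤ) * N) : ℚ) / (2 ^ (m + 3) : ℕ) -
        (Int.gcdB ((2 ^ (m + 2) : ℕ) : ℤ) ((A : ℤ) * N) : ℚ) / (2 ^ (m + 2) : ℕ))) := by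
    simp only [hP, hE, hcβ]; exact_mod_cast hS2
  have hP3 : P (m + 2) A - P (m + 1) Abar = -12 * E (m + 2) A + cβ * ((N : ℚ) *
      ((Int.gcdB ((2 ^ (m + 2) : ℕ) : ℤ) (A * N) : ℚ) / (2 ^ (m + 2) : ℕ) -
        (Int.gcdB ((2 ^ (m + 1) : ℕ) : ℤ) ((Abar : ℤ) * N) : ℚ) / (2 ^ (m + 1) : ℕ))) := by
    simp only [hP, hE, hcβ, hAbar]; exact_mod_cast hS3
  -- the Dedekind part is an exact distribution on the η = +1 lifts
  have hEv : ∀ {k : ℕ} (hk : 2 ≤ k) (x : ZMod (2 ^ k)), x.val % 4 = 1 →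
      eisensteinDedekindTwo N.divisors (stabCoeff N β) k x = ((E k x.val : ℚ) : ℚ_[2]) := fun hk x hx ↦ by
    rw [eisensteinDedekindTwo_apply_of_mod_four hodd hk x hx]
  have hdist := eisensteinDedekindTwo_distribution N.divisors (stabCoeff N β) hT (m + 2) a
  rw [sum_filter_castHom_eq_add (m + 2) _ a, hEv (by omega) b₁ hb₁4, hEv (by omega) b₂ hb₂4, hEv (by omega) a ha,
    hb₁v, hb₂v] at hdist
  -- `hdist : cast E(m+3, A) + cast E(m+3, A + 2^(m+2)) = cast E(m+2, A)`
  -- the Bézout part: `Y₁ + Y₂ − 6Y + 4Ȳ = 2^L + 2^{L+1} q`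
  have hF1 := two_pow_dvd_bezout hodd (m + 3) (X := (A : ℤ)) (by exact_mod_cast hAodd)
  have hF2 := two_pow_dvd_bezout hodd (m + 3) (X := ((A + 2 ^ (m + 2) : ℕ) : ℤ)) (by exact_mod_cast hAodd2)
  have hF3 := two_pow_dvd_bezout hodd (m + 2) (X := (A : ℤ)) (by exact_mod_cast hAodd)
  have hF4 := two_pow_dvd_bezout hodd (m + 1) (X := (Abar : ℤ)) (by
    have : Odd Abar := odd_mod_two_pow hAodd (by omega); exact_mod_cast this)
  set Y₁ := (N : ℤ) * Int.gcdB ((2 ^ (m + 3) : ℕ) : ℤ) ((A : ℤ) * N) with hY₁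
  set Y₂ := (N : ℤ) * Int.gcdB ((2 ^ (m + 3) : ℕ) : ℤ) (((A + 2 ^ (m + 2) : ℕ) : ℤ) * N) with hY₂
  set Y₀ := (N : ℤ) * Int.gcdB ((2 ^ (m + 2) : ℕ) : ℤ) ((A : ℤ) * N) with hY₀
  set Yb := (N : ℤ) * Int.gcdB ((2 ^ (m + 1) : ℕ) : ℤ) ((Abar : ℤ) * N) with hYb
  have hpow1 : ((2 ^ (m + 2) : ℕ) : ℤ) ∣ ((2 ^ (m + 3) : ℕ) : ℤ) := by exact_mod_cast pow_dvd_pow 2 (by omega : m + 2 ≤ m + 3)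
  have hpow2 : ((2 ^ (m + 1) : ℕ) : ℤ) ∣ ((2 ^ (m + 3) : ℕ) : ℤ) := by exact_mod_cast pow_dvd_pow 2 (by omega : m + 1 ≤ m + 3)
  have hpow3 : ((2 ^ (m + 1) : ℕ) : ℤ) ∣ ((2 ^ (m + 2) : ℕ) : ℤ) := by exact_mod_cast pow_dvd_pow 2 (by omega : m + 1 ≤ m + 2)
  have hAodd' : Odd (A : ℤ) := by exact_mod_cast hAodd
  -- (D1) `2^(m+2) ∣ Y₁ − Y₀`
  have hD1 : ((2 ^ (m + 2) : ℕ) : ℤ) ∣ Y₁ - Y₀ :=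
    two_pow_dvd_sub_of_inverses hAodd' (hpow1.trans hF1) hF3 (by simp)
  -- (D2) `2^(m+1) ∣ Y₁ − Yb`
  have hmodA : ((2 ^ (m + 1) : ℕ) : ℤ) ∣ (A : ℤ) - (Abar : ℤ) := by
    rw [hAbar]; push_cast; exact (Nat.mod_modEq A (2 ^ (m + 1))).symm.dvd |> fun h ↦ by
      rwa [← dvd_neg, neg_sub] at h
  have hD2 : ((2 ^ (m + 1) : ℕ) : ℤ) ∣ Y₁ - Yb :=
    two_pow_dvd_sub_of_inverses hAodd' (hpow2.trans hF1) hF4 hmodA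
  -- (D3) `2^(m+3) ∣ Y₂ − Y₁ − 2^(m+2)`
  have hY₂odd : Odd Y₂ := by
    have h2 : (2 : ℤ) ∣ ((2 ^ (m + 3) : ℕ) : ℤ) := by exact_mod_cast dvd_pow_self 2 (by omega : m + 3 ≠ 0)
    have h := h2.trans hF2
    rw [← Int.not_even_iff_odd]
    intro hev
    have : (2 : ℤ) ∣ 1 := by
      have e : (1 : ℤ) = ((A + 2 ^ (m + 2) : ℕ) : ℤ) * Y₂ - (((A + 2 ^ (m + 2) : ℕ) : ℤ) * Y₂ - 1) := by ring
      rw [e]; exact dvd_sub (dvd_mul_of_dvd_right (even_iff_two_dvd.mp hev) _) h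
    omega
  have hD3 : ((2 ^ (m + 3) : ℕ) : ℤ) ∣ Y₂ - Y₁ - ((2 ^ (m + 2) : ℕ) : ℤ) := by
    refine two_pow_dvd_of_dvd_odd_mul hAodd' ?_
    obtain ⟨w, hw⟩ : Even (Y₂ + A) := hY₂odd.add_odd hAodd'
    have e : (A : ℤ) * (Y₂ - Y₁ - ((2 ^ (m + 2) : ℕ) : ℤ)) =
        (((A + 2 ^ (m + 2) : ℕ) : ℤ) * Y₂ - 1) - ((A : ℤ) * Y₁ - 1) - ((2 ^ (m + 3) : ℕ) : ℤ) * w := by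
      push_cast; linear_combination (-(2 : ℤ) ^ (m + 2)) * hw
    rw [e]
    exact dvd_sub (dvd_sub hF2 hF1) (dvd_mul_right _ _)
  -- the numerator
  have hnum : ((2 ^ (m + 3) : ℕ) : ℤ) ∣ Y₁ + Y₂ - 6 * Y₀ + 4 * Yb - ((2 ^ (m + 2) : ℕ) : ℤ) := by
    have e : Y₁ + Y₂ - 6 * Y₀ + 4 * Yb - ((2 ^ (m + 2) : ℕ) : ℤ) =
        (Y₂ - Y₁ - ((2 ^ (m + 2) : ℕ) : ℤ)) - 3 * (2 * (Y₀ - Y₁)) + 4 * (Yb - Y₁) := by ring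
    rw [e]
    refine dvd_add (dvd_sub hD3 (dvd_mul_of_dvd_right ?_ _)) ?_
    · have : ((2 ^ (m + 3) : ℕ) : ℤ) = 2 * ((2 ^ (m + 2) : ℕ) : ℤ) := by push_cast; ring
      rw [this]; exact mul_dvd_mul_left 2 ((dvd_neg.mpr hD1) |> fun h ↦ by rwa [neg_sub] at h)
    · have : ((2 ^ (m + 3) : ℕ) : ℤ) = 4 * ((2 ^ (m + 1) : ℕ) : ℤ) := by push_cast; ring
      rw [this]; exact mul_dvd_mul_left 4 ((dvd_neg.mpr hD2) |> fun h ↦ by rwa [neg_sub] at h)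
  obtain ⟨q, hq⟩ := hnum
  -- assemble: the whole expression is `cβ · (½ + q)` in `ℚ_[2]`
  have hTq : (N : ℚ) * ((Int.gcdB ((2 ^ (m + 3) : ℕ) : ℤ) (A * N) : ℚ) / (2 ^ (m + 3) : ℕ) -
        (Int.gcdB ((2 ^ (m + 2) : ℕ) : ℤ) ((A : ℤ) * N) : ℚ) / (2 ^ (m + 2) : ℕ)) +
      (N : ℚ) * ((Int.gcdB ((2 ^ (m + 3) : ℕ) : ℤ) (((A + 2 ^ (m + 2) : ℕ) : ℤ) * N) : ℚ) / (2 ^ (m + 3) : ℕ) -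
        (Int.gcdB ((2 ^ (m + 2) : ℕ) : ℤ) ((A : ℤ) * N) : ℚ) / (2 ^ (m + 2) : ℕ)) -
      (N : ℚ) * ((Int.gcdB ((2 ^ (m + 2) : ℕ) : ℤ) (A * N) : ℚ) / (2 ^ (m + 2) : ℕ) -
        (Int.gcdB ((2 ^ (m + 1) : ℕ) : ℤ) ((Abar : ℤ) * N) : ℚ) / (2 ^ (m + 1) : ℕ)) = 1 / 2 + q := by
    have hq' : (Y₁ : ℚ) + Y₂ - 6 * Y₀ + 4 * Yb - ((2 ^ (m + 2) : ℕ) : ℚ) = ((2 ^ (m + 3) : ℕ) : ℚ) * q := by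
      exact_mod_cast hq
    simp only [hY₁, hY₂, hY₀, hYb] at hq'
    push_cast at hq' ⊢
    have hD : (2 : ℚ) ^ (m + 3) ≠ 0 := by positivity
    rw [← sub_eq_zero]
    have e : (N : ℚ) * ((Int.gcdB (2 ^ (m + 3)) ((A : ℤ) * N) : ℚ) / 2 ^ (m + 3) -
          (Int.gcdB (2 ^ (m + 2)) ((A : ℤ) * N) : ℚ) / 2 ^ (m + 2)) +
        (N : ℚ) * ((Int.gcdB (2 ^ (m + 3)) (((A : ℤ) + 2 ^ (m + 2)) * N) : ℚ) / 2 ^ (m + 3) -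
          (Int.gcdB (2 ^ (m + 2)) ((A : ℤ) * N) : ℚ) / 2 ^ (m + 2)) -
        (N : ℚ) * ((Int.gcdB (2 ^ (m + 2)) ((A : ℤ) * N) : ℚ) / 2 ^ (m + 2) -
          (Int.gcdB (2 ^ (m + 1)) ((Abar : ℤ) * N) : ℚ) / 2 ^ (m + 1)) - (1 / 2 + (q : ℚ)) =
        (((N : ℚ) * (Int.gcdB (2 ^ (m + 3)) ((A : ℤ) * N) : ℚ) +
          (N : ℚ) * (Int.gcdB (2 ^ (m + 3)) (((A : ℤ) + 2 ^ (m + 2)) * N) : ℚ) -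
          6 * ((N : ℚ) * (Int.gcdB (2 ^ (m + 2)) ((A : ℤ) * N) : ℚ)) +
          4 * ((N : ℚ) * (Int.gcdB (2 ^ (m + 1)) ((Abar : ℤ) * N) : ℚ)) - 2 ^ (m + 2)) - 2 ^ (m + 3) * q) /
          2 ^ (m + 3) := by
      field_simp
      ring
    rw [e, div_eq_zero_iff]
    left
    linear_combination hq'
  have hQ : (P (m + 3) A - P (m + 2) A) + (P (m + 3) (A + 2 ^ (m + 2)) - P (m + 2) A) -
      (P (m + 2) A - P (m + 1) Abar) =
      -12 * (E (m + 3) A + E (m + 3) (A + 2 ^ (m + 2)) - E (m + 2) A) + cβ * (1 / 2 + q) := by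
    rw [hP1, hP2, hP3]
    linear_combination cβ * hTq
  have hEsum : ((E (m + 3) A : ℚ) : ℚ_[2]) + ((E (m + 3) (A + 2 ^ (m + 2)) : ℚ) : ℚ_[2]) -
      ((E (m + 2) A : ℚ) : ℚ_[2]) = 0 := by
    rw [show m + 2 + 1 = m + 3 from rfl] at hdist
    rw [← hdist]; ring
  have hfinal : ((((P (m + 3) A - P (m + 2) A) + (P (m + 3) (A + 2 ^ (m + 2)) - P (m + 2) A) -
      (P (m + 2) A - P (m + 1) Abar) : ℚ)) : ℚ_[2]) = ((cβ : ℚ) : ℚ_[2]) * (((1 / 2 + q : ℚ)) : ℚ_[2]) := by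
    rw [hQ]
    push_cast at hEsum ⊢
    linear_combination (-12 : ℚ_[2]) * hEsum
  rw [hfinal, norm_mul]
  have hcβn : ‖((cβ : ℚ) : ℚ_[2])‖ ≤ (2 : ℝ) ^ (-(4 : ℤ)) := norm_cBeta_le hN hodd hadm
  have hhalf : ‖(((1 / 2 + q : ℚ)) : ℚ_[2])‖ ≤ 2 := by
    push_cast
    refine (Padic.nonarchimedean _ _).trans (max_le ?_ ((Padic.norm_int_le_one q).trans (by norm_num)))
    rw [norm_div, norm_one, show ‖(2 : ℚ_[2])‖ = 2⁻¹ by exact_mod_cast Padic.norm_p (p := 2)]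
    norm_num
  calc ‖((cβ : ℚ) : ℚ_[2])‖ * ‖(((1 / 2 + q : ℚ)) : ℚ_[2])‖ ≤ (2 : ℝ) ^ (-(4 : ℤ)) * 2 :=
        mul_le_mul hcβn hhalf (norm_nonneg _) (by positivity)
    _ = 8⁻¹ := by norm_num

/-- **The `α = 1` cusp differences are `≡ 0 (mod 8)`**: for `m ≥ 1` and every `η = +1` class `a` of level `m + 2`,
`‖v(m+2, A) − v(m+1, Ā)‖₂ ≤ 8⁻¹` — lit GEN 21's mod-`8` rigidity `norm_le_eighth_of_stevensSmoothing` (p558349) applied to the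
cusp-difference function with (i)–(iv) above. [cite: Stevens1982, §5.2, §5.4 (PDF pp. 68–69, 73)] [cite: Washington1997, §7.2] -/
theorem norm_cuspDiff_le_eighth (hodd : Odd N) (hadm : IsAdmissibleStabData N β) {m : ℕ} (hm : 1 ≤ m)
    (a : ZMod (2 ^ (m + 2))) (ha : a.val % 4 = 1) :
    ‖(((stabEisCuspDiff N β (m + 2) (a.val : ℤ) -
        stabEisCuspDiff N β (m + 1) ((a.val % 2 ^ (m + 1) : ℕ) : ℤ) : ℚ)) : ℚ_[2])‖ ≤ 8⁻¹ := by
  set f : (n : ℕ) → ZMod (2 ^ n) → ℚ_[2] := fun n b ↦ if 3 ≤ n ∧ b.val % 4 = 1 then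
    (((stabEisCuspDiff N β n (b.val : ℤ) - stabEisCuspDiff N β (n - 1) ((b.val % 2 ^ (n - 1) : ℕ) : ℤ) : ℚ)) : ℚ_[2])
    else 0 with hf
  have hval : ∀ {k : ℕ} (hk : 1 ≤ k) (x : ZMod (2 ^ (k + 2))), x.val % 4 = 1 →
      f (k + 2) x = (((stabEisCuspDiff N β (k + 2) (x.val : ℤ) -
        stabEisCuspDiff N β (k + 1) ((x.val % 2 ^ (k + 1) : ℕ) : ℤ) : ℚ)) : ℚ_[2]) := fun {k} hk x hx ↦ by
    simp only [hf, if_pos (show 3 ≤ k + 2 ∧ x.val % 4 = 1 from ⟨by omega, hx⟩), show k + 2 - 1 = k + 1 from rfl]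
  have h := norm_le_eighth_of_stevensSmoothing (f := f) (m₀ := 1) ?_ ?_ ?_ ?_ hm a ha
  · rwa [hval hm a ha] at h
  · -- (i) integrality
    intro k hk x hx
    rw [hval hk x hx]
    push_cast
    refine norm_sub_le_of_le_two ?_ ?_
    · exact norm_stabEisCuspDiff_le_one hodd β _ (by exact_mod_cast odd_val_of_mod_four x hx)
    · exact norm_stabEisCuspDiff_le_one hodd β _ (by
        exact_mod_cast odd_mod_two_pow (odd_val_of_mod_four x hx) (by omega))
  · -- (ii) smoothing
    intro k hk x hx
    exact norm_stevensSmoothing_cuspDiff_le_eighth hodd hadm (by omega) x hx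
  · -- (iii) tower
    intro k hk
    exact norm_tower_cuspDiff_le_eighth hodd hadm hk
  · -- (iv) the class of 1
    intro k hk
    haveI : NeZero (2 ^ (k + 2)) := ⟨pow_ne_zero _ two_ne_zero⟩
    have h1 : (1 : ZMod (2 ^ (k + 2))).val = 1 := by
      rw [ZMod.val_one_eq_one_mod, Nat.mod_eq_of_lt (Nat.one_lt_two_pow (by omega))]
    have h1' : (1 : ℕ) % 2 ^ (k + 1) = 1 := Nat.mod_eq_of_lt (Nat.one_lt_two_pow (by omega))
    simp only [hf, h1]
    rw [show k + 2 - 1 = k + 1 from rfl, h1', Nat.cast_one, stabEisCuspDiff_one, stabEisCuspDiff_one, sub_self,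
      Rat.cast_zero, ite_self]

/-- **(★-EisEight₂) — `8 ∣ v` on `C`, `2`-adically: `‖stabEisCuspDiff N β m a‖₂ ≤ 8⁻¹` for `(m, a) ∈ C`**, odd `N`,
admissible `β` (telescoping the `α = 1` differences down to `v(2, 1) = 0`). This is the corrected form (lit GEN 21) of the
registered `stub_starEisEight` of `Cruxes/…/Lines/star.lean` v3; in the `ℤ`-form `∃ n, v = 8n` the statement is false
(`v ∈ ℤ[1/rad N]`). [cite: Stevens1982, §5.4 (PDF p. 73)] [cite: RademacherGrosswald1972, Ch. 4 A] -/
theorem starEisEight₂ (N : ℕ) (hodd : Odd N) (β : ℕ → ℕ) (hadm : IsAdmissibleStabData N β) (m : ℕ) (a : ℤ)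
    (h : InC m a) : ‖((stabEisCuspDiff N β m a : ℚ) : ℚ_[2])‖ ≤ 8⁻¹ := by
  obtain ⟨hm, ha4, ha1, halt⟩ := h
  -- induction on the level: `‖v(k+2, A)‖ ≤ 8⁻¹` for all `A ≡ 1 (4)`, `A < 2^{k+2}`
  have key : ∀ k : ℕ, ∀ A : ℕ, A % 4 = 1 → A < 2 ^ (k + 2) →
      ‖((stabEisCuspDiff N β (k + 2) (A : ℤ) : ℚ) : ℚ_[2])‖ ≤ 8⁻¹ := by
    intro k
    induction k with
    | zero =>
      intro A hA hlt
      have : A = 1 := by omega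
      subst this
      rw [Nat.cast_one, stabEisCuspDiff_one]; simp
    | succ k ih =>
      intro A hA hlt
      haveI : NeZero (2 ^ (k + 1 + 2)) := ⟨pow_ne_zero _ two_ne_zero⟩
      set x : ZMod (2 ^ (k + 1 + 2)) := ((A : ℕ) : ZMod (2 ^ (k + 1 + 2))) with hx
      have hxv : x.val = A := by rw [hx, ZMod.val_natCast, Nat.mod_eq_of_lt hlt]
      have hstep := norm_cuspDiff_le_eighth hodd hadm (show 1 ≤ k + 1 by omega) x (by rw [hxv]; exact hA)
      rw [hxv, show k + 1 + 1 = k + 2 from rfl] at hstep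
      have h4 : 4 ∣ 2 ^ (k + 2) := ⟨2 ^ k, by ring⟩
      have hrec := ih (A % 2 ^ (k + 2)) (by rw [Nat.mod_mod_of_dvd _ h4]; exact hA) (Nat.mod_lt _ (by positivity))
      have e : ((stabEisCuspDiff N β (k + 1 + 2) (A : ℤ) : ℚ) : ℚ_[2]) =
          (((stabEisCuspDiff N β (k + 1 + 2) (A : ℤ) -
              stabEisCuspDiff N β (k + 2) ((A % 2 ^ (k + 2) : ℕ) : ℤ) : ℚ)) : ℚ_[2]) +
            ((stabEisCuspDiff N β (k + 2) ((A % 2 ^ (k + 2) : ℕ) : ℤ) : ℚ) : ℚ_[2]) := by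
        push_cast; ring
      rw [e]
      exact norm_add_le_of_le_two hstep hrec
  obtain ⟨k, rfl⟩ := Nat.exists_eq_add_of_le' (by omega : 2 ≤ m)
  obtain ⟨A, rfl⟩ := Int.eq_ofNat_of_zero_le (by omega : 0 ≤ a)
  exact key k A (by omega) (by exact_mod_cast halt)

end EisEight

end Summit.BirchSwinnertonDyer.BirchSwinnertonDyer.Theorems.DepletionAtTwo

end
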